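import Mathlib
import HarnessLib
import Summits.HubbardSuperconductivity.HubbardSuperconductivity.Theorems.KLProgrammeKLRegimeEngineLastStepResponseBracketFlowSharp
import Summits.HubbardSuperconductivity.HubbardSuperconductivity.Theorems.KLProgrammeKLRegimeEngineLastRespSymbolSupsFlow

/-!
# K3 gen-8-FLOW (stmt 20437, stub (C), located item #20, cure (δ′) «LAST-STEP SWAP», layer F3f′): THE RESPONSE BRACKET AT THE FLOW FRAMES, SHARP,
# WITH THE SYMBOL SUPS DISCHARGED FROM ENGINE DATA — `lastResponse_bracket_flow_sharp_env`

Cell gate-hubbard-kl, seat p2 g20.  `lastResponse_bracket_flow_sharp` (p617972) reads six FUNCTION-SUP hypotheses `hDg_X : ∀ q, ‖D^{Mg}(symbol_X)(q)‖ ≤ Dg_X`,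
`hA₀_X : ∀ q, ‖symbol_X(q)‖ ≤ A₀_X` (`X ∈ {a,b,c}`: `−J₂`, `J₁`, `−i·J₁` at the flow frames `(K_{n_β}, K_{n_β+1})`).  By `…EngineLastRespSymbolSupsFlow`
(§3, closed envelopes) these hold with EXPLICIT Gevrey-2 expressions in `(R, Ξ, Θ, β, L, n_β, Mg)` once the history of piece jets / reading jets at every
scale `m ≤ n_β` is in hand (`hPh`, `hT` — the (C)-induction's own data), `0 < Gfr₀`, and ONE `U`-door
`Gfr₀|U| + (Σ_{j<5}Gfr_j + π⁸W/2^{11})U² ≤ 1/512` (`W = curveExtC X₄ G.S 1 + curveExtC X₄ Q.S′ 1·|U|`, `X₄ = klChi2CauchyTab2 4`).  This file is that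
composition: the six function sups become six SCALAR inequalities `EXPR_X(Mg) ≤ Dg_X`, `EXPR_X(0) ≤ A₀_X` (parameters `W, Ξ, Θ` bound by their defining
equations `hW, hΞ, hΘ`; `Dg_X, A₀_X` stay free so the alias rows `hAL_X` are byte-identical to p617972's).  Every other hypothesis and the conclusion are
verbatim those of `lastResponse_bracket_flow_sharp`; remaining asks (by name, unchanged): `hZn` (analyticity lane), the moments `Mm_b/Ms_b`, `Mm_c/Ms_c`
(E1 / class-#7), the alias rows `AL_X`, Bell rows `PP_b, PP_c, AA_X` (curve table explicit) and the sizes `Zb, Zc, ZA_X`, `hZt/hZtU/hCU`.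

* **`lastResponse_bracket_flow_sharp_env`**.

Composition only; no definitions; nothing asserts superconductivity.  Refs: BGM 2006 §2.2 (2.23), (2.27)–(2.28), §2.4 Lemma 2.1 (2.36)–(2.42), §3 (3.2)
[cite: BenfattoGiulianiMastropietro2006]; FST 1996 §1 [cite: FeldmanSalmhoferTrubowitz1996].
-/

noncomputable section

namespace Summit.HubbardSuperconductivity.HubbardSuperconductivity.Theorems.EngineV8

set_option linter.dupNamespace false -- summit = problem name (single-conjunct summit), D-0017

open Complex Real Finset Filter Literature.MathematicalPhysics.QuantumLattice Literature.Probability.LatticeModels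
open Literature.MathematicalPhysics.QuantumLattice.BandSectorCounting
open Literature.Analysis.Fourier Literature.Analysis.Calculus
open Summit.HubbardSuperconductivity.HubbardSuperconductivity.Theorems.KLRegimeSplit
open Summit.HubbardSuperconductivity.HubbardSuperconductivity.Theorems.DispersionFlow
open Summit.HubbardSuperconductivity.HubbardSuperconductivity.Theorems.KLProgrammeLegKernels
open Summit.HubbardSuperconductivity.HubbardSuperconductivity.Theorems.PerturbedFermiCurve
open scoped Nat

section FlowSharpEnv

variable {L M : ℕ} [NeZero L] [NeZero M]

set_option maxHeartbeats 400000 in -- heartbeat disclosure (R137): ≈ 120-binder statement + one 70-argument composition; whnf-times-out at 200k, farm-green at 400k (31 s)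
/-- **THE RESPONSE BRACKET AT THE FLOW FRAMES, SHARP CONSTANTS, SYMBOL SUPS FROM ENGINE DATA** — see the module docstring.  Output = `(hRdiff, hR)` of
`twoLegReadPriv_flow_succ_of_swap_lit` at `n = nScales β` with `eR = fun k => if k = 0 then 0 else 1`, `eR' = fun k => if k = 0 then 1 else 0`. -/
theorem lastResponse_bracket_flow_sharp_env {R : RenConsts} (hR : ∀ j, 0 ≤ R.Gfr j) {c : ℝ} (hc : 0 < c) (hcle : c ≤ klCurveC3 R)
    {U : ℝ} (hU : 0 < U) (hU1 : U ≤ 1) (hUle : U ≤ klCurveU0 R) {β : ℝ} (hβmin : klBetaMin ≤ β) (hβc : β ≤ Real.exp (c / U ^ 2))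
    {μ : ℝ} (hμ : μ ∈ klWindowC) (hK : FrameOK R U (nScales β) μ (klFlowFrameU L M β U μ (nScales β))) {G : GeoConsts} {Q : EngConsts} (hGS : ∀ k, 0 ≤ G.S k) (hQS : ∀ k, 0 ≤ Q.S' k) (hR0 : 0 < R.Gfr 0)
    (hPh : ∀ m ≤ nScales β, FlowPieceJetsAt L M β U μ R m) (hT : ∀ m ≤ nScales β, TwoLegReadJetsF L M G Q β U μ m) {W Ξ Θ : ℝ}
    (hW : W = curveExtC (klChi2CauchyTab2 4) G.S 1 + curveExtC (klChi2CauchyTab2 4) Q.S' 1 * |U|) (hΞ : Ξ = 2 ^ 10 * (1 + Real.pi ^ 8 * (W * U ^ 2) / 2 ^ 11) + ∑ j ∈ range 5, R.Gfr j)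
    (hΘ : Θ = 1 + ((∑ j ∈ range 5, R.Gfr j) + Real.pi ^ 8 * W / 2 ^ 11) * |U| / R.Gfr 0)
    (hdoor : R.Gfr 0 * |U| + ((∑ j ∈ range 5, R.Gfr j) + Real.pi ^ 8 * W / 2 ^ 11) * U ^ 2 ≤ 1 / 512)
    (hZn : IsUnit (effPartitionFn ℂ (normalCovariance L M (uvSymbolCT L M β μ (klFlowFrameU L M β U μ (nScales β + 1)) (klScale klE0 (nScales β + 1))))
      (hubbardInteraction L M β U + counterQuadratic L M β (klFlowFrameU L M β U μ (nScales β + 1)))))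
    {Zt Zb Zc ZAa ZAb ZAc : ℝ} (hZt : 128 * (R.Gfr 0 + R.Gfr 1 + R.Gfr 2 + R.Gfr 3 + R.Gfr 4) * (1696963596321 + 925 * (10 ^ 14 * (1 + R.Gfr 3 + R.Gfr 4))) ≤ Zt) (hZtU : 2 * Zt * U ≤ 1)
    (hCU : 16 * (2 ^ 29 * (1 / 32) * Zt ^ 3 * (1696963596321 + 925 * (10 ^ 14 * (1 + R.Gfr 3 + R.Gfr 4))) + 2 ^ 38 * Zt ^ 2 * Zb + 2 ^ 33 * Zt * Zc + (ZAa + ZAb + ZAc)) * U ≤ 1)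
    {Mg : ℕ} (hMg : 8 ≤ Mg) {s : ℕ}
    {Dga : ℝ}
    (hDga : ((R.Gfr 0 * |U| * Θ * ((16 : ℝ) ^ nScales β)⁻¹) * (R.Gfr 0 * |U| * Θ * ((16 : ℝ) ^ nScales β)⁻¹) / |(β * (L : ℝ) ^ 2)|) * ((5 : ℝ) * (|(β * (L : ℝ) ^ 2)| * (6 / (klScale klE0
      (nScales β + 1))))) * ((Mg ! : ℝ)) ^ 2 * (2 * (2 * (2 ^ 10 * (1 : ℝ) * (4 : ℝ) ^ nScales β) + 2 * (4 * (2 * (4 * (4 + (4 : ℝ) ^ nScales β * Ξ) * (1 + 16 * (1 + (27 / 10 : ℝ)) /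
      (klScale klE0 (nScales β + 1)) * 1) + (2 ^ 10 * (1 : ℝ) * (4 : ℝ) ^ nScales β))) * (1 + 6 / (klScale klE0 (nScales β + 1)) * ((klScale klE0 (nScales β + 1)) / 128 + (5 : ℝ) *
      (R.Gfr 0 * |U| * Θ * ((16 : ℝ) ^ nScales β)⁻¹)))))) ^ Mg ≤ Dga)
    {A₀a : ℝ}
    (hA₀a : ((R.Gfr 0 * |U| * Θ * ((16 : ℝ) ^ nScales β)⁻¹) * (R.Gfr 0 * |U| * Θ * ((16 : ℝ) ^ nScales β)⁻¹) / |(β * (L : ℝ) ^ 2)|) * ((5 : ℝ) * (|(β * (L : ℝ) ^ 2)| * (6 / (klScale klE0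
      (nScales β + 1))))) * ((0 ! : ℝ)) ^ 2 * (2 * (2 * (2 ^ 10 * (1 : ℝ) * (4 : ℝ) ^ nScales β) + 2 * (4 * (2 * (4 * (4 + (4 : ℝ) ^ nScales β * Ξ) * (1 + 16 * (1 + (27 / 10 : ℝ)) /
      (klScale klE0 (nScales β + 1)) * 1) + (2 ^ 10 * (1 : ℝ) * (4 : ℝ) ^ nScales β))) * (1 + 6 / (klScale klE0 (nScales β + 1)) * ((klScale klE0 (nScales β + 1)) / 128 + (5 : ℝ) *
      (R.Gfr 0 * |U| * Θ * ((16 : ℝ) ^ nScales β)⁻¹)))))) ^ 0 ≤ A₀a)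
    {Dgb : ℝ}
    (hDgb : ((R.Gfr 0 * |U| * Θ * ((16 : ℝ) ^ nScales β)⁻¹) / |(β * (L : ℝ) ^ 2)| * ((5 : ℝ) * (|(β * (L : ℝ) ^ 2)| * (6 / (klScale klE0 (nScales β + 1)))))) * ((R.Gfr 0 * |U| * Θ * ((16 :
      ℝ) ^ nScales β)⁻¹) / |(β * (L : ℝ) ^ 2)| * ((5 : ℝ) * (|(β * (L : ℝ) ^ 2)| * (6 / (klScale klE0 (nScales β + 1)))))) * ((Mg ! : ℝ)) ^ 2 * (2 * (2 * (2 * (2 ^ 10 * (1 : ℝ) * (4 :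
      ℝ) ^ nScales β) + 2 * (4 * (2 * (4 * (4 + (4 : ℝ) ^ nScales β * Ξ) * (1 + 16 * (1 + (27 / 10 : ℝ)) / (klScale klE0 (nScales β + 1)) * 1) + (2 ^ 10 * (1 : ℝ) * (4 : ℝ) ^ nScales
      β))) * (1 + 6 / (klScale klE0 (nScales β + 1)) * ((klScale klE0 (nScales β + 1)) / 128 + (5 : ℝ) * (R.Gfr 0 * |U| * Θ * ((16 : ℝ) ^ nScales β)⁻¹))))))) ^ Mg + 2 * (((R.Gfr 0 *
      |U| * Θ * ((16 : ℝ) ^ nScales β)⁻¹) / |(β * (L : ℝ) ^ 2)|) * ((5 : ℝ) * (|(β * (L : ℝ) ^ 2)| * (6 / (klScale klE0 (nScales β + 1))))) * ((Mg ! : ℝ)) ^ 2 * (2 * (2 * (2 ^ 10 * (1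
      : ℝ) * (4 : ℝ) ^ nScales β) + 2 * (4 * (2 * (4 * (4 + (4 : ℝ) ^ nScales β * Ξ) * (1 + 16 * (1 + (27 / 10 : ℝ)) / (klScale klE0 (nScales β + 1)) * 1) + (2 ^ 10 * (1 : ℝ) * (4 : ℝ)
      ^ nScales β))) * (1 + 6 / (klScale klE0 (nScales β + 1)) * ((klScale klE0 (nScales β + 1)) / 128 + (5 : ℝ) * (R.Gfr 0 * |U| * Θ * ((16 : ℝ) ^ nScales β)⁻¹)))))) ^ Mg) ≤ Dgb)
    {A₀b : ℝ}
    (hA₀b : ((R.Gfr 0 * |U| * Θ * ((16 : ℝ) ^ nScales β)⁻¹) / |(β * (L : ℝ) ^ 2)| * ((5 : ℝ) * (|(β * (L : ℝ) ^ 2)| * (6 / (klScale klE0 (nScales β + 1)))))) * ((R.Gfr 0 * |U| * Θ * ((16 :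
      ℝ) ^ nScales β)⁻¹) / |(β * (L : ℝ) ^ 2)| * ((5 : ℝ) * (|(β * (L : ℝ) ^ 2)| * (6 / (klScale klE0 (nScales β + 1)))))) * ((0 ! : ℝ)) ^ 2 * (2 * (2 * (2 * (2 ^ 10 * (1 : ℝ) * (4 :
      ℝ) ^ nScales β) + 2 * (4 * (2 * (4 * (4 + (4 : ℝ) ^ nScales β * Ξ) * (1 + 16 * (1 + (27 / 10 : ℝ)) / (klScale klE0 (nScales β + 1)) * 1) + (2 ^ 10 * (1 : ℝ) * (4 : ℝ) ^ nScales
      β))) * (1 + 6 / (klScale klE0 (nScales β + 1)) * ((klScale klE0 (nScales β + 1)) / 128 + (5 : ℝ) * (R.Gfr 0 * |U| * Θ * ((16 : ℝ) ^ nScales β)⁻¹))))))) ^ 0 + 2 * (((R.Gfr 0 * |U|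
      * Θ * ((16 : ℝ) ^ nScales β)⁻¹) / |(β * (L : ℝ) ^ 2)|) * ((5 : ℝ) * (|(β * (L : ℝ) ^ 2)| * (6 / (klScale klE0 (nScales β + 1))))) * ((0 ! : ℝ)) ^ 2 * (2 * (2 * (2 ^ 10 * (1 : ℝ)
      * (4 : ℝ) ^ nScales β) + 2 * (4 * (2 * (4 * (4 + (4 : ℝ) ^ nScales β * Ξ) * (1 + 16 * (1 + (27 / 10 : ℝ)) / (klScale klE0 (nScales β + 1)) * 1) + (2 ^ 10 * (1 : ℝ) * (4 : ℝ) ^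
      nScales β))) * (1 + 6 / (klScale klE0 (nScales β + 1)) * ((klScale klE0 (nScales β + 1)) / 128 + (5 : ℝ) * (R.Gfr 0 * |U| * Θ * ((16 : ℝ) ^ nScales β)⁻¹)))))) ^ 0) ≤ A₀b)
    {Mmb : ℕ → ℝ} (hMmb : ∀ m ≤ 4, ∑ x : TorusSite 2 L, (1 + ((x 0).valMinAbs.natAbs : ℝ) + ((x 1).valMinAbs.natAbs : ℝ)) ^ m *
      ‖torusFourierInv (fun k => ((((fun k : TorusSite 2 L => klLocSelfEnergyRe L M β U μ (klFlowFrameU L M β U μ (nScales β + 1)) (nScales β + 1) k) k : ℝ)) : ℂ)) x‖ ≤ Mmb m)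
    {Msb : ℝ} (hMsb : ∑ x : TorusSite 2 L, (1 + ((x 0).valMinAbs.natAbs : ℝ) + ((x 1).valMinAbs.natAbs : ℝ)) ^ s *
      ‖torusFourierInv (fun k => ((((fun k : TorusSite 2 L => klLocSelfEnergyRe L M β U μ (klFlowFrameU L M β U μ (nScales β + 1)) (nScales β + 1) k) k : ℝ)) : ℂ)) x‖ ≤ Msb)
    {Dgc : ℝ}
    (hDgc : ((R.Gfr 0 * |U| * Θ * ((16 : ℝ) ^ nScales β)⁻¹) / |(β * (L : ℝ) ^ 2)| * ((5 : ℝ) * (|(β * (L : ℝ) ^ 2)| * (6 / (klScale klE0 (nScales β + 1)))))) * ((R.Gfr 0 * |U| * Θ * ((16 :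
      ℝ) ^ nScales β)⁻¹) / |(β * (L : ℝ) ^ 2)| * ((5 : ℝ) * (|(β * (L : ℝ) ^ 2)| * (6 / (klScale klE0 (nScales β + 1)))))) * ((Mg ! : ℝ)) ^ 2 * (2 * (2 * (2 * (2 ^ 10 * (1 : ℝ) * (4 :
      ℝ) ^ nScales β) + 2 * (4 * (2 * (4 * (4 + (4 : ℝ) ^ nScales β * Ξ) * (1 + 16 * (1 + (27 / 10 : ℝ)) / (klScale klE0 (nScales β + 1)) * 1) + (2 ^ 10 * (1 : ℝ) * (4 : ℝ) ^ nScales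
      β))) * (1 + 6 / (klScale klE0 (nScales β + 1)) * ((klScale klE0 (nScales β + 1)) / 128 + (5 : ℝ) * (R.Gfr 0 * |U| * Θ * ((16 : ℝ) ^ nScales β)⁻¹))))))) ^ Mg + 2 * (((R.Gfr 0 *
      |U| * Θ * ((16 : ℝ) ^ nScales β)⁻¹) / |(β * (L : ℝ) ^ 2)|) * ((5 : ℝ) * (|(β * (L : ℝ) ^ 2)| * (6 / (klScale klE0 (nScales β + 1))))) * ((Mg ! : ℝ)) ^ 2 * (2 * (2 * (2 ^ 10 * (1
      : ℝ) * (4 : ℝ) ^ nScales β) + 2 * (4 * (2 * (4 * (4 + (4 : ℝ) ^ nScales β * Ξ) * (1 + 16 * (1 + (27 / 10 : ℝ)) / (klScale klE0 (nScales β + 1)) * 1) + (2 ^ 10 * (1 : ℝ) * (4 : ℝ)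
      ^ nScales β))) * (1 + 6 / (klScale klE0 (nScales β + 1)) * ((klScale klE0 (nScales β + 1)) / 128 + (5 : ℝ) * (R.Gfr 0 * |U| * Θ * ((16 : ℝ) ^ nScales β)⁻¹)))))) ^ Mg) ≤ Dgc)
    {A₀c : ℝ}
    (hA₀c : ((R.Gfr 0 * |U| * Θ * ((16 : ℝ) ^ nScales β)⁻¹) / |(β * (L : ℝ) ^ 2)| * ((5 : ℝ) * (|(β * (L : ℝ) ^ 2)| * (6 / (klScale klE0 (nScales β + 1)))))) * ((R.Gfr 0 * |U| * Θ * ((16 :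
      ℝ) ^ nScales β)⁻¹) / |(β * (L : ℝ) ^ 2)| * ((5 : ℝ) * (|(β * (L : ℝ) ^ 2)| * (6 / (klScale klE0 (nScales β + 1)))))) * ((0 ! : ℝ)) ^ 2 * (2 * (2 * (2 * (2 ^ 10 * (1 : ℝ) * (4 :
      ℝ) ^ nScales β) + 2 * (4 * (2 * (4 * (4 + (4 : ℝ) ^ nScales β * Ξ) * (1 + 16 * (1 + (27 / 10 : ℝ)) / (klScale klE0 (nScales β + 1)) * 1) + (2 ^ 10 * (1 : ℝ) * (4 : ℝ) ^ nScales
      β))) * (1 + 6 / (klScale klE0 (nScales β + 1)) * ((klScale klE0 (nScales β + 1)) / 128 + (5 : ℝ) * (R.Gfr 0 * |U| * Θ * ((16 : ℝ) ^ nScales β)⁻¹))))))) ^ 0 + 2 * (((R.Gfr 0 * |U|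
      * Θ * ((16 : ℝ) ^ nScales β)⁻¹) / |(β * (L : ℝ) ^ 2)|) * ((5 : ℝ) * (|(β * (L : ℝ) ^ 2)| * (6 / (klScale klE0 (nScales β + 1))))) * ((0 ! : ℝ)) ^ 2 * (2 * (2 * (2 ^ 10 * (1 : ℝ)
      * (4 : ℝ) ^ nScales β) + 2 * (4 * (2 * (4 * (4 + (4 : ℝ) ^ nScales β * Ξ) * (1 + 16 * (1 + (27 / 10 : ℝ)) / (klScale klE0 (nScales β + 1)) * 1) + (2 ^ 10 * (1 : ℝ) * (4 : ℝ) ^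
      nScales β))) * (1 + 6 / (klScale klE0 (nScales β + 1)) * ((klScale klE0 (nScales β + 1)) / 128 + (5 : ℝ) * (R.Gfr 0 * |U| * Θ * ((16 : ℝ) ^ nScales β)⁻¹)))))) ^ 0) ≤ A₀c)
    {Mmc : ℕ → ℝ} (hMmc : ∀ m ≤ 4, ∑ x : TorusSite 2 L, (1 + ((x 0).valMinAbs.natAbs : ℝ) + ((x 1).valMinAbs.natAbs : ℝ)) ^ m *
      ‖torusFourierInv (fun k => ((((fun k : TorusSite 2 L => (∑ s : Fin 2, ((klSelfEnergy L M β U μ (klFlowFrameU L M β U μ (nScales β + 1)) klE0 (nScales β + 1) (omega0 M, k) s).im -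
          (klSelfEnergy L M β U μ (klFlowFrameU L M β U μ (nScales β + 1)) klE0 (nScales β + 1) ((omega0 M).rev, k) s).im)) / 4) k : ℝ)) : ℂ)) x‖ ≤ Mmc m)
    {Msc : ℝ} (hMsc : ∑ x : TorusSite 2 L, (1 + ((x 0).valMinAbs.natAbs : ℝ) + ((x 1).valMinAbs.natAbs : ℝ)) ^ s *
      ‖torusFourierInv (fun k => ((((fun k : TorusSite 2 L => (∑ s : Fin 2, ((klSelfEnergy L M β U μ (klFlowFrameU L M β U μ (nScales β + 1)) klE0 (nScales β + 1) (omega0 M, k) s).im -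
          (klSelfEnergy L M β U μ (klFlowFrameU L M β U μ (nScales β + 1)) klE0 (nScales β + 1) ((omega0 M).rev, k) s).im)) / 4) k : ℝ)) : ℂ)) x‖ ≤ Msc)
    {ALa : ℕ → ℝ}
    (hALa : ∀ j ≤ 4, 2 * (2 * (1 * ((3 : ℝ) ^ j * Dga * (2 / ((2 * (L / 4 + 1) : ℕ) : ℝ)) ^ (Mg - j - 4) *
        (2 ^ 2 * ∑' k : Fin 2 → ℤ, ∏ i, (1 + (k i : ℝ) ^ 2)⁻¹)))) + (L : ℝ) ^ 2 * (L : ℝ) ^ j * (A₀a * (1 / (1 + (L : ℝ) / 4) ^ s)) ≤ ALa j)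
    {AAa : ℕ → ℝ} (hAAa0 : ALa 0 ≤ AAa 0) (hAAa1 : ALa 1 * klCurveD1 ≤ AAa 1) (hAAa2 : ALa 2 * klCurveD1 ^ 2 + ALa 1 * klCurveD2 ≤ AAa 2)
    (hAAa3 : ALa 3 * klCurveD1 ^ 3 + 3 * ALa 2 * klCurveD1 * klCurveD2 + ALa 1 * (klCurveD3 (R.Gfr 3 * U ^ 2 * ((4 : ℝ) ^ (nScales β + 1) / 3))) ≤ AAa 3)
    (hAAa4 : ALa 4 * klCurveD1 ^ 4 + 6 * ALa 3 * klCurveD1 ^ 2 * klCurveD2 + 3 * ALa 2 * klCurveD2 ^ 2 + 4 * ALa 2 * klCurveD1 * (klCurveD3 (R.Gfr 3 * U ^ 2 * ((4 : ℝ) ^ (nScales β +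
        1) / 3))) + ALa 1 * (klCurveD4 (R.Gfr 3 * U ^ 2 * ((4 : ℝ) ^ (nScales β + 1) / 3)) (R.Gfr 4 * U ^ 2 * ((16 : ℝ) ^ (nScales β + 1) / 15))) ≤ AAa 4)
    {ALb : ℕ → ℝ}
    (hALb : ∀ j ≤ 4, 2 * (2 * (Mmb j * ((3 : ℝ) ^ j * Dgb * (2 / ((2 * (L / 4 + 1) : ℕ) : ℝ)) ^ (Mg - j - 4) *
        (2 ^ 2 * ∑' k : Fin 2 → ℤ, ∏ i, (1 + (k i : ℝ) ^ 2)⁻¹)))) + (L : ℝ) ^ 2 * (L : ℝ) ^ j * (A₀b * (Msb / (1 + (L : ℝ) / 4) ^ s)) ≤ ALb j)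
    {PPb : ℕ → ℝ} (hPPb0 : Mmb 0 ≤ PPb 0) (hPPb1 : Mmb 1 * klCurveD1 ≤ PPb 1) (hPPb2 : Mmb 2 * klCurveD1 ^ 2 + Mmb 1 * klCurveD2 ≤ PPb 2)
    (hPPb3 : Mmb 3 * klCurveD1 ^ 3 + 3 * Mmb 2 * klCurveD1 * klCurveD2 + Mmb 1 * (klCurveD3 (R.Gfr 3 * U ^ 2 * ((4 : ℝ) ^ (nScales β + 1) / 3))) ≤ PPb 3)
    (hPPb4 : Mmb 4 * klCurveD1 ^ 4 + 6 * Mmb 3 * klCurveD1 ^ 2 * klCurveD2 + 3 * Mmb 2 * klCurveD2 ^ 2 + 4 * Mmb 2 * klCurveD1 * (klCurveD3 (R.Gfr 3 * U ^ 2 * ((4 : ℝ) ^ (nScales β +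
        1) / 3))) + Mmb 1 * (klCurveD4 (R.Gfr 3 * U ^ 2 * ((4 : ℝ) ^ (nScales β + 1) / 3)) (R.Gfr 4 * U ^ 2 * ((16 : ℝ) ^ (nScales β + 1) / 15))) ≤ PPb 4)
    {AAb : ℕ → ℝ} (hAAb0 : ALb 0 ≤ AAb 0) (hAAb1 : ALb 1 * klCurveD1 ≤ AAb 1) (hAAb2 : ALb 2 * klCurveD1 ^ 2 + ALb 1 * klCurveD2 ≤ AAb 2)
    (hAAb3 : ALb 3 * klCurveD1 ^ 3 + 3 * ALb 2 * klCurveD1 * klCurveD2 + ALb 1 * (klCurveD3 (R.Gfr 3 * U ^ 2 * ((4 : ℝ) ^ (nScales β + 1) / 3))) ≤ AAb 3)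
    (hAAb4 : ALb 4 * klCurveD1 ^ 4 + 6 * ALb 3 * klCurveD1 ^ 2 * klCurveD2 + 3 * ALb 2 * klCurveD2 ^ 2 + 4 * ALb 2 * klCurveD1 * (klCurveD3 (R.Gfr 3 * U ^ 2 * ((4 : ℝ) ^ (nScales β +
        1) / 3))) + ALb 1 * (klCurveD4 (R.Gfr 3 * U ^ 2 * ((4 : ℝ) ^ (nScales β + 1) / 3)) (R.Gfr 4 * U ^ 2 * ((16 : ℝ) ^ (nScales β + 1) / 15))) ≤ AAb 4)
    {ALc : ℕ → ℝ}
    (hALc : ∀ j ≤ 4, 2 * (2 * (Mmc j * ((3 : ℝ) ^ j * Dgc * (2 / ((2 * (L / 4 + 1) : ℕ) : ℝ)) ^ (Mg - j - 4) *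
        (2 ^ 2 * ∑' k : Fin 2 → ℤ, ∏ i, (1 + (k i : ℝ) ^ 2)⁻¹)))) + (L : ℝ) ^ 2 * (L : ℝ) ^ j * (A₀c * (Msc / (1 + (L : ℝ) / 4) ^ s)) ≤ ALc j)
    {PPc : ℕ → ℝ} (hPPc0 : Mmc 0 ≤ PPc 0) (hPPc1 : Mmc 1 * klCurveD1 ≤ PPc 1) (hPPc2 : Mmc 2 * klCurveD1 ^ 2 + Mmc 1 * klCurveD2 ≤ PPc 2)
    (hPPc3 : Mmc 3 * klCurveD1 ^ 3 + 3 * Mmc 2 * klCurveD1 * klCurveD2 + Mmc 1 * (klCurveD3 (R.Gfr 3 * U ^ 2 * ((4 : ℝ) ^ (nScales β + 1) / 3))) ≤ PPc 3)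
    (hPPc4 : Mmc 4 * klCurveD1 ^ 4 + 6 * Mmc 3 * klCurveD1 ^ 2 * klCurveD2 + 3 * Mmc 2 * klCurveD2 ^ 2 + 4 * Mmc 2 * klCurveD1 * (klCurveD3 (R.Gfr 3 * U ^ 2 * ((4 : ℝ) ^ (nScales β +
        1) / 3))) + Mmc 1 * (klCurveD4 (R.Gfr 3 * U ^ 2 * ((4 : ℝ) ^ (nScales β + 1) / 3)) (R.Gfr 4 * U ^ 2 * ((16 : ℝ) ^ (nScales β + 1) / 15))) ≤ PPc 4)
    {AAc : ℕ → ℝ} (hAAc0 : ALc 0 ≤ AAc 0) (hAAc1 : ALc 1 * klCurveD1 ≤ AAc 1) (hAAc2 : ALc 2 * klCurveD1 ^ 2 + ALc 1 * klCurveD2 ≤ AAc 2)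
    (hAAc3 : ALc 3 * klCurveD1 ^ 3 + 3 * ALc 2 * klCurveD1 * klCurveD2 + ALc 1 * (klCurveD3 (R.Gfr 3 * U ^ 2 * ((4 : ℝ) ^ (nScales β + 1) / 3))) ≤ AAc 3)
    (hAAc4 : ALc 4 * klCurveD1 ^ 4 + 6 * ALc 3 * klCurveD1 ^ 2 * klCurveD2 + 3 * ALc 2 * klCurveD2 ^ 2 + 4 * ALc 2 * klCurveD1 * (klCurveD3 (R.Gfr 3 * U ^ 2 * ((4 : ℝ) ^ (nScales β +
        1) / 3))) + ALc 1 * (klCurveD4 (R.Gfr 3 * U ^ 2 * ((4 : ℝ) ^ (nScales β + 1) / 3)) (R.Gfr 4 * U ^ 2 * ((16 : ℝ) ^ (nScales β + 1) / 15))) ≤ AAc 4)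
    (hPPbs : ∀ j ≤ 4, PPb j ≤ Zb * U * ((4 : ℝ) ^ nScales β) ^ j)
    (hPPcs : ∀ j ≤ 4, PPc j ≤ Zc * U ^ 2 * ((4 : ℝ) ^ nScales β) ^ j / ((4 : ℝ) ^ nScales β))
    (hAAas : ∀ k ≤ 4, AAa k ≤ ZAa * U ^ 3 * ((4 : ℝ) ^ nScales β) ^ k / ((4 : ℝ) ^ nScales β) ^ 2) (hAAbs : ∀ k ≤ 4, AAb k ≤ ZAb * U ^ 3 * ((4 : ℝ) ^ nScales β) ^ k / ((4 : ℝ) ^ nScales β) ^ 2)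
    (hAAcs : ∀ k ≤ 4, AAc k ≤ ZAc * U ^ 3 * ((4 : ℝ) ^ nScales β) ^ k / ((4 : ℝ) ^ nScales β) ^ 2) :
    ContDiff ℝ 4 (fun θ : ℝ => (symInterp L (fun k => klLocSelfEnergyRe L M β U μ (klFlowFrameU L M β U μ (nScales β + 1)) (nScales β + 1) k -
            (klFlowFrameU L M β U μ (nScales β + 1)).eval (latticeMomentum L k))).eval (klFermiPoint μ (klFlowFrameU L M β U μ (nScales β)) θ) -
        (symInterp L (fun k => klLocSelfEnergyRe L M β U μ (klFlowFrameU L M β U μ (nScales β)) (nScales β + 1) k -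
            (klFlowFrameU L M β U μ (nScales β)).eval (latticeMomentum L k))).eval (klFermiPoint μ (klFlowFrameU L M β U μ (nScales β)) θ)) ∧
    ∀ k ≤ 4, ∀ θ : ℝ, |iteratedDeriv k (fun θ : ℝ => (symInterp L (fun k => klLocSelfEnergyRe L M β U μ (klFlowFrameU L M β U μ (nScales β + 1)) (nScales β + 1) k -
            (klFlowFrameU L M β U μ (nScales β + 1)).eval (latticeMomentum L k))).eval (klFermiPoint μ (klFlowFrameU L M β U μ (nScales β)) θ) -
        (symInterp L (fun k => klLocSelfEnergyRe L M β U μ (klFlowFrameU L M β U μ (nScales β)) (nScales β + 1) k -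
            (klFlowFrameU L M β U μ (nScales β)).eval (latticeMomentum L k))).eval (klFermiPoint μ (klFlowFrameU L M β U μ (nScales β)) θ)) θ| ≤
      curveJetBar (fun k => if k = 0 then 0 else 1) (fun k => if k = 0 then 1 else 0) U k (nScales β + 1) := by
  have hβ0 : 0 < β := KLRegimeSplit.pos_of_klBetaMin_le hβmin
  have hU1' : |U| ≤ 1 := by rw [abs_of_pos hU]; exact hU1
  -- the three closed Gevrey sups at the last flow step `m = n_β`
  have hSa := fun k q => lastNegJ₂_sup_flow_le_closed (L := L) (M := M) hR hR0 hGS hQS hβ0 hμ hU1' hPh hT (le_refl (nScales β)) hW hΞ hΘ hdoor k q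
  have hSb := fun k q => lastJ₁_sup_flow_le_closed (L := L) (M := M) hR hR0 hGS hQS hβ0 hμ hU1' hPh hT (le_refl (nScales β)) hW hΞ hΘ hdoor k q
  have hSc := fun k q => lastNegIJ₁_sup_flow_le_closed (L := L) (M := M) hR hR0 hGS hQS hβ0 hμ hU1' hPh hT (le_refl (nScales β)) hW hΞ hΘ hdoor k q
  exact lastResponse_bracket_flow_sharp hR hc hcle hU hU1 hUle hβmin hβc hμ hK (hPh _ le_rfl) hZn hZt hZtU hCU hMg
    (fun q => (hSa Mg q).trans hDga) (fun q => by have h := hSa 0 q; rw [norm_iteratedFDeriv_zero] at h; exact h.trans hA₀a)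
    (fun q => (hSb Mg q).trans hDgb) (fun q => by have h := hSb 0 q; rw [norm_iteratedFDeriv_zero] at h; exact h.trans hA₀b) hMmb hMsb
    (fun q => (hSc Mg q).trans hDgc) (fun q => by have h := hSc 0 q; rw [norm_iteratedFDeriv_zero] at h; exact h.trans hA₀c) hMmc hMsc
    hALa hAAa0 hAAa1 hAAa2 hAAa3 hAAa4
    hALb hPPb0 hPPb1 hPPb2 hPPb3 hPPb4 hAAb0 hAAb1 hAAb2 hAAb3 hAAb4
    hALc hPPc0 hPPc1 hPPc2 hPPc3 hPPc4 hAAc0 hAAc1 hAAc2 hAAc3 hAAc4 hPPbs hPPcs hAAas hAAbs hAAcs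

end FlowSharpEnv

end Summit.HubbardSuperconductivity.HubbardSuperconductivity.Theorems.EngineV8

end
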